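import Summits.Ventures.HodgeRepro2.T6A2ShadowS
import Summits.Ventures.HodgeRepro2.T6A3ShadowFix
import Summits.Ventures.HodgeRepro2.T6InterfaceOfData

/-!
# T6A2ShadowData — the assembly: **`shadowDataOf`**, the lead's `OfData.ShadowData F` (hence
`TransferShadow.ofData`) built from the A2 carrier, the displayed facts of `T6A2Gysin`, and the identification
data `IdentB` (T6A2Shadow) / `IdentBB'` (T6A3ShadowFix, t6-p3's repair R9 of `IdentBB`) / `IdentS`
(T6A2ShadowS)

Cell pub-hodge-repro2, Tier 6 (README §10), seat t6-p2 (A2 owner). Continues `T6A2ShadowS.lean`, whose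
`zOf_proj_even` / `zOf_proj` are typed over the R9-false `IdentBB` (append-only: they stay; this file re-proves
them over `IdentBB'` as `zOf_proj_even'` / `zOf_proj'` — same proofs on the shared `ψ`-fields — and supplies
`intBOf'_deg` / `intBOf'_ne_zero`). Definition lane: the defs `shadowDataOf`, `transferShadowOf`.
`zOf_proj_even'` / `zOf_proj'` = TIER4 (A4.1.1) `∫_B z ∪ u = ∫_S f^*u` (`integral_z_mul` = Lemma A4.1.1(ii)
on even `u`; on odd `u` both sides vanish by degree; `DirectSum.sum_support_decompose` glues). The two fields
of `ShadowData` that are NOT discharged from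
the A2 carrier are taken as hypotheses of `shadowDataOf`: `alg_lefschetz` (`hLef`; TIER4 (A4.2.4), the Voisin
displays of `T6A2Hyp` discharge it in `T6A2LefProofs` modulo the divisor-class datum) and the identification
of the Pontryagin coproduct with the model's shuffle coproduct (`hcop_ev`), together with the identification
`hBB` of the model's `∫_{B×B}` with the Künneth extension `OfData.intBBOf K intB` (Layer III, R9).
No `sorry`; standard axioms.
§8(d): uses an L-value-free non-vanishing device: NO.
-/

namespace Summit.Ventures.HodgeRepro2.T6.A2Shadow

open Summit.Ventures.HodgeRepro2.T6 Summit.Ventures.HodgeRepro2.T6.A2Gysin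
  Summit.Ventures.HodgeRepro2.T6.A3ShadowFix

universe u

section identS

variable {𝒞 : CycleTheory.{u}} {σ : A2Situation 𝒞} {K : Type*} [Field K] [NumberField K]

/-- `intB := ∫_B ∘ ψ` kills every degree `≠ 24` (`ShadowData.intB_deg`), for t6-p3's repaired `IdentBB'`
(the proof of `IdentBB.intBOf_deg`, T6A2Shadow, verbatim on the shared `ψ`-fields). -/
theorem intBOf'_deg {I : IdentB σ K} {hPD : 𝒞.PoincareDuality} {intBB : HBB K →ₗ[ℚ] ℚ}
    (J : IdentBB' I hPD intBB) :
    ∀ k ≠ 24, ∀ a ∈ degB K k, J.intBOf a = 0 := by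
  intro k hk a ha
  rcases Nat.even_or_odd k with ⟨j, hj⟩ | ⟨j, hj⟩
  · have hj' : k = 2 * j := by omega
    rw [hj'] at ha
    have : j ≠ 12 := by omega
    exact J.int_deg j this a ha
  · rw [hj] at ha
    simp [IdentBB'.intBOf, J.ψ_odd j a ha]

/-- `intB ≠ 0` on the top degree (`ShadowData.intB_ne_zero`), for `IdentBB'`. -/
theorem intBOf'_ne_zero {I : IdentB σ K} {hPD : 𝒞.PoincareDuality} {intBB : HBB K →ₗ[ℚ] ℚ}
    (J : IdentBB' I hPD intBB) :
    ∃ a ∈ degB K 24, J.intBOf a ≠ 0 := J.int_ne_zero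

namespace IdentS

variable {I : IdentB σ K} {hPD : 𝒞.PoincareDuality} {HS : Type*} [Ring HS] [Algebra ℂ HS]
  {pull : HBC K →ₐ[ℂ] HS} {intS : HS →ₗ[ℂ] ℂ} (S : IdentS I hPD HS pull intS)

include S

/-- TIER4 (S1), the projection formula `∫_B z ∪ u = ∫_S f^*u`, on even-degree `u`
(`integral_z_mul` = Lemma A4.1.1(ii) for `f`, transported by `ev` / `ψ` / `evS`). -/
theorem zOf_proj_even' {intBB : HBB K →ₗ[ℚ] ℚ} (J : IdentBB' I hPD intBB) (hCap : 𝒞.BredonCapProduct)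
    (hAug : 𝒞.AugmentationNatural)
    (j : ℕ) (u : HB K) (hu : u ∈ degB K (2 * j)) :
    ((J.intBOf (I.zOf hPD * u) : ℚ) : ℂ) = intS (pull (extC K u)) := by
  have hu' : I.ev (J.ψ u) = u := J.ev_ψ_even j u hu
  have hmul : I.zOf hPD * u = I.ev (σ.z hPD * J.ψ u) := by rw [IdentB.zOf, map_mul, hu']
  have hR : intS (pull (extC K u)) = ((𝒞.integral σ.S (𝒞.pull σ.f (J.ψ u)) : ℚ) : ℂ) := by
    conv_lhs => rw [← hu']
    rw [S.pull_extC, S.intS_evS]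
  rw [hmul, hR]
  simp only [IdentBB'.intBOf, LinearMap.comp_apply, J.ψ_ev]
  rw [σ.integral_z_mul hPD hCap hAug]

/-- TIER4 (S1), the projection formula for EVERY `u` (`TransferShadow.z_proj`): on odd degrees both sides
vanish (the degree of `z ∪ u` is odd; `intS_odd`), the rest is the decomposition into homogeneous parts. -/
theorem zOf_proj' {intBB : HBB K →ₗ[ℚ] ℚ} (J : IdentBB' I hPD intBB) (hCap : 𝒞.BredonCapProduct)
    (hAug : 𝒞.AugmentationNatural)
    (u : HB K) : ((J.intBOf (I.zOf hPD * u) : ℚ) : ℂ) = intS (pull (extC K u)) := by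
  classical
  let L : HB K →+ ℂ :=
    (algebraMap ℚ ℂ).toAddMonoidHom.comp
      (J.intBOf.toAddMonoidHom.comp (LinearMap.mulLeft ℚ (I.zOf hPD)).toAddMonoidHom)
  let R : HB K →+ ℂ :=
    intS.toAddMonoidHom.comp ((pull : HBC K →+* HS).toAddMonoidHom.comp (extC K : HB K →+* HBC K).toAddMonoidHom)
  have hcomp : ∀ (i : ℕ) (v : HB K), v ∈ degB K i → L v = R v := by
    intro i v hv
    rcases Nat.even_or_odd i with ⟨j, hj⟩ | ⟨j, hj⟩
    · have hv' : v ∈ degB K (2 * j) := by rw [hj] at hv; convert hv using 2; ring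
      exact S.zOf_proj_even' J hCap hAug j v hv'
    · rw [hj] at hv
      have hL : J.intBOf (I.zOf hPD * v) = 0 := by
        refine intBOf'_deg J (20 + (2 * j + 1)) (by omega) _ ?_
        exact SetLike.mul_mem_graded (A := fun i : ℕ => ⋀[ℚ]^i (H1 K)) S.z_deg hv
      show (algebraMap ℚ ℂ) (J.intBOf (I.zOf hPD * v)) = intS (pull (extC K v))
      rw [hL, map_zero, S.intS_odd j v hv]
  have : L u = R u := by
    rw [← DirectSum.sum_support_decompose (fun i : ℕ => ⋀[ℚ]^i (H1 K)) u, map_sum, map_sum]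
    exact Finset.sum_congr rfl fun i _ => hcomp i _ (SetLike.coe_mem _)
  exact this

end IdentS

end identS

section assembly

variable {𝒞 : CycleTheory.{u}} {σ : A2Situation 𝒞} {K : Type*} [Field K] [NumberField K]

/-- THE ASSEMBLY — the lead's `OfData.ShadowData F` from the A2 carrier (TIER4 (S1)–(S3), (S4)(ii),
(A4.1.1)–(A4.1.2) in kernel: `T6A2GysinProofs`, `T6A2Shadow`, `T6A3ShadowFix`, this file) and the
identification data. Inputs: the five displayed facts of `T6A2Gysin` the proofs consume (`hCap`, `hAug`,
`hF1`, `hR`) and the product orientation `hProd` (`T6A2Shadow` display #9); the identification data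
`I : IdentB σ K`, `J : IdentBB' I hPD intBB` (R9 form) with `hBB : intBB = OfData.intBBOf K J.intBOf` (the
model's `∫_{B×B}` IS the Künneth extension of `∫_B`) and `hcop_ev` (the Pontryagin coproduct `m^*` read through
`evBB` is the model's shuffle coproduct `Toy.cop K`), `S : IdentS I hPD HS pull intS`; and `hLef` = the
field `alg_lefschetz` (TIER4 (A4.2.4): a rational `(1,1)`-class of `B` is algebraic — `T6A2LefProofs`
discharges it from the Voisin displays of `T6A2Hyp` and the divisor-class datum). `hProd` is not used by the
R9 form of the Pontryagin characterisation (`int_evBB` replaces the Künneth span) and is therefore not a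
binder here. -/
noncomputable def shadowDataOf (F : FaceSetting K) (hPD : 𝒞.PoincareDuality) (hCap : 𝒞.BredonCapProduct)
    (hAug : 𝒞.AugmentationNatural) (hF1 : 𝒞.FultonProperPushForward) (hR : 𝒞.FultonCycleClassRingHom)
    (I : IdentB σ K) {intBB : HBB K →ₗ[ℚ] ℚ} (J : IdentBB' I hPD intBB)
    (hBB : intBB = OfData.intBBOf K J.intBOf)
    (hcop_ev : ∀ a, J.evBB (𝒞.pull σ.m a) = Toy.cop K (I.ev a))
    {HS : Type} [Ring HS] [Algebra ℂ HS] {pull : HBC K →ₐ[ℂ] HS} {intS : HS →ₗ[ℂ] ℂ}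
    (S : IdentS I hPD HS pull intS)
    (hLef : ∀ a ∈ degB K 2, extC K a ∈ hodge F 1 1 → a ∈ I.algOf 1) : OfData.ShadowData F where
  Alg := I.algOf
  alg_deg := I.algOf_le_degB
  alg_one := I.one_mem_algOf hR
  alg_mul := I.mul_mem_algOf hR
  alg_pull := I.pullEndo_mem_algOf hR
  alg_lefschetz := hLef
  intB := J.intBOf
  intB_deg := intBOf'_deg J
  intB_ne_zero := intBOf'_ne_zero J
  alg_pont_even := by
    intro k l a b ha hb
    obtain ⟨p, hp, hpu⟩ := J.exists_pont_char' hCap hAug hF1 hR (Toy.cop K) hcop_ev ha hb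
    exact ⟨p, hp, fun j u hu => (hpu j u hu).trans (DFunLike.congr_fun hBB _)⟩
  HS := HS
  pull := pull
  intS := intS
  z := I.zOf hPD
  z_deg := S.z_deg
  z_alg := S.zOf_mem_algOf hF1 hR
  z_proj := S.zOf_proj' J hCap hAug

/-- The interface's `TransferShadow F` of the A2 carrier: `TransferShadow.ofData` of `shadowDataOf`. -/
noncomputable def transferShadowOf (F : FaceSetting K) (hPD : 𝒞.PoincareDuality) (hCap : 𝒞.BredonCapProduct)
    (hAug : 𝒞.AugmentationNatural) (hF1 : 𝒞.FultonProperPushForward) (hR : 𝒞.FultonCycleClassRingHom)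
    (I : IdentB σ K) {intBB : HBB K →ₗ[ℚ] ℚ} (J : IdentBB' I hPD intBB)
    (hBB : intBB = OfData.intBBOf K J.intBOf)
    (hcop_ev : ∀ a, J.evBB (𝒞.pull σ.m a) = Toy.cop K (I.ev a))
    {HS : Type} [Ring HS] [Algebra ℂ HS] {pull : HBC K →ₐ[ℂ] HS} {intS : HS →ₗ[ℂ] ℂ}
    (S : IdentS I hPD HS pull intS)
    (hLef : ∀ a ∈ degB K 2, extC K a ∈ hodge F 1 1 → a ∈ I.algOf 1) : TransferShadow F :=
  TransferShadow.ofData (shadowDataOf F hPD hCap hAug hF1 hR I J hBB hcop_ev S hLef)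

/-- The algebraic classes of the assembled shadow are the carrier's (`I.algOf`). -/
@[simp] theorem transferShadowOf_Alg (F : FaceSetting K) (hPD : 𝒞.PoincareDuality)
    (hCap : 𝒞.BredonCapProduct) (hAug : 𝒞.AugmentationNatural) (hF1 : 𝒞.FultonProperPushForward)
    (hR : 𝒞.FultonCycleClassRingHom) (I : IdentB σ K) {intBB : HBB K →ₗ[ℚ] ℚ} (J : IdentBB' I hPD intBB)
    (hBB : intBB = OfData.intBBOf K J.intBOf)
    (hcop_ev : ∀ a, J.evBB (𝒞.pull σ.m a) = Toy.cop K (I.ev a))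
    {HS : Type} [Ring HS] [Algebra ℂ HS] {pull : HBC K →ₐ[ℂ] HS} {intS : HS →ₗ[ℂ] ℂ}
    (S : IdentS I hPD HS pull intS)
    (hLef : ∀ a ∈ degB K 2, extC K a ∈ hodge F 1 1 → a ∈ I.algOf 1) :
    (transferShadowOf F hPD hCap hAug hF1 hR I J hBB hcop_ev S hLef).Alg = I.algOf := rfl

end assembly

end Summit.Ventures.HodgeRepro2.T6.A2Shadow
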